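import Summits.CriticalPhenomena.PercolationContinuityZ3.Theorems.PercNearOneGluingNoHeavyLowerTailTypedReductions
import Summits.CriticalPhenomena.PercolationContinuityZ3.Theorems.PercNearOneGluingNoHeavyLowerTailHalfLeSevenForms
import HarnessLib

/-!
# `NoHeavyLowerTail` (stmt-CriticalPhenomena-4575) — the CUMULATIVE ISOLATION LEMMA closes the crux

Typed reduction (lead of the one-cut line, 2026-08-18).  For bond percolation `μ = prodBernoulli w` on `Fin n`,
a relay set `A`, an observer `o` and a vertex `v` write `π(v) = C(v) ∩ A` for the set of relays in the open
cluster of `v` and `N = |π(o)|`.  The CUMULATIVE ISOLATION LEMMA at level `j` is the "maximum principle"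

  `CIL_j :  P(1 ≤ N ≤ j) ≤ max_{a ∈ A} P(|π(a)| ≤ j)`

("the probability of lying in a nonempty relay block of size `≤ j` is maximised at a relay"; equality when
`o` is glued to a relay).  Level `j = 1` is the landed lonely-relay lemma `Theorems.lonelyRelay`
(Kozma–Nitzan Lemma 2); the general level is OPEN (0 violations in exact enumeration, `n ≤ 9`; crux
evidence `CIL.md`).  This file PROVES that the family `CIL_{⌊|A|/2⌋}` implies the crux, k-uniformly and
with constant 2:

* `smallBlock_le_two_mul` — pair counting: if `P(a ↮ a') ≤ η` for all `a' ∈ A` then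
  `P(2|π(a)| ≤ |A|) ≤ 2η` for `a ∈ A` (on the event `a` is cut from at least half of the relays; Markov).
* `fatMinorityLinear_of_cumulativeIsolation` — `CIL ⇒ stub_fatMinorityLinear` with `d₀ = 0`, `C = 2`:
  `P(0 < N ∧ 2N ≤ |A|) ≤ 2η ≤ 2 (P(o ↮ A) + η)`.
* `noHeavyLowerTail_of_cumulativeIsolation` — `CIL ⇒ NoHeavyLowerTail`, by the landed
  `noHeavyLowerTail_of_fatMinorityLinear`.

The hypothesis `CIL` is stated with the maximum realised by SOME relay (`∃ a ∈ A, …`), for nonempty `A` and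
`o ∉ A`, at the single level `j = ⌊|A|/2⌋` that the reduction uses (the conjecture is for every `j`).
-/

noncomputable section

namespace Summit.CriticalPhenomena.PercolationContinuityZ3.Theorems

open MeasureTheory Set Literature.Probability.LatticeModels Literature.Probability.Percolation
open Summit.CriticalPhenomena.PercolationContinuityZ3.Theses.PercNearOneGluing
open scoped Classical BigOperators

/-- **Pair counting for a relay in a minority block.**  If `a ∈ A` and `P(a ↮ a') ≤ η` for every
`a' ∈ A`, then `P(2 · |π(a)| ≤ |A|) ≤ 2η`, `π(a) = {a' ∈ A : a ↔ a'}`: on the event, `a` is disconnected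
from at least `|A|/2` relays, while the expected number of relays disconnected from `a` is `≤ |A| η`. -/
theorem smallBlock_le_two_mul {n : ℕ} (w : Sym2 (Fin n) → unitInterval) (A : Finset (Fin n))
    (a : Fin n) (η : ℝ) (ha : a ∈ A)
    (hpair : ∀ a' ∈ A, (prodBernoulli w).real (openConn a a' : Set (BondConfig (Fin n)))ᶜ ≤ η) :
    (prodBernoulli w).real {ω : BondConfig (Fin n) |
        2 * (A.filter fun a' => ω ∈ openConn a a').card ≤ A.card} ≤ 2 * η := by
  have hmeas : ∀ s : Set (BondConfig (Fin n)), MeasurableSet s :=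
    fun _ => MeasurableSet.of_discrete
  set P := prodBernoulli w with hP
  set D : Set (BondConfig (Fin n)) := {ω : BondConfig (Fin n) |
      2 * (A.filter fun a' => ω ∈ openConn a a').card ≤ A.card} with hD
  set m : ℝ := (A.card : ℝ) with hm
  have hmpos : 0 < m := by rw [hm]; exact_mod_cast Finset.card_pos.2 ⟨a, ha⟩
  have hcount : m / 2 * P.real D ≤
      ∑ a' ∈ A, P.real (D ∩ (openConn a a' : Set (BondConfig (Fin n)))ᶜ) := by
    refine halfLeSevenForms_mul_measureReal_le_sum_inter P A
      (fun a' => (openConn a a' : Set (BondConfig (Fin n)))ᶜ) (fun _ _ => hmeas _) (hmeas D)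
      (m / 2) fun ω hω => ?_
    have hind : ∀ a' ∈ A,
        ((openConn a a' : Set (BondConfig (Fin n)))ᶜ).indicator (fun _ => (1 : ℝ)) ω =
          if ¬ ω ∈ (openConn a a' : Set (BondConfig (Fin n))) then (1 : ℝ) else 0 := by
      intro a' _
      by_cases h' : ω ∈ (openConn a a' : Set (BondConfig (Fin n)))
      · rw [if_neg (not_not.2 h'), Set.indicator_of_notMem (Set.notMem_compl_iff.2 h')]
      · rw [if_pos h', Set.indicator_of_mem (show ω ∈ (openConn a a' : Set (BondConfig (Fin n)))ᶜ
          from h')]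
    rw [Finset.sum_congr rfl hind, Finset.sum_boole]
    have hhalf : 2 * (A.filter fun a' => ω ∈ (openConn a a' : Set (BondConfig (Fin n)))).card ≤
        A.card := hω
    have hsplit := Finset.card_filter_add_card_filter_not (s := A)
      (fun a' => ω ∈ (openConn a a' : Set (BondConfig (Fin n))))
    have hcast : ((A.filter fun a' => ω ∈ (openConn a a' : Set (BondConfig (Fin n)))).card : ℝ) +
        ((A.filter fun a' => ¬ ω ∈ (openConn a a' : Set (BondConfig (Fin n)))).card : ℝ) = m := by
      rw [hm]; exact_mod_cast hsplit
    have hhalf' : 2 * ((A.filter fun a' => ω ∈ (openConn a a' : Set (BondConfig (Fin n)))).card : ℝ)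
        ≤ m := by
      rw [hm]; exact_mod_cast hhalf
    linarith
  have hsum : ∑ a' ∈ A, P.real (D ∩ (openConn a a' : Set (BondConfig (Fin n)))ᶜ) ≤ m * η := by
    calc ∑ a' ∈ A, P.real (D ∩ (openConn a a' : Set (BondConfig (Fin n)))ᶜ)
        ≤ ∑ a' ∈ A, η := Finset.sum_le_sum fun a' ha' =>
          (measureReal_mono Set.inter_subset_right (measure_ne_top _ _)).trans (hpair a' ha')
      _ = m * η := by rw [Finset.sum_const, nsmul_eq_mul, hm]
  have h2 : m / 2 * P.real D ≤ m / 2 * (2 * η) := by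
    calc m / 2 * P.real D ≤ m * η := hcount.trans hsum
      _ = m / 2 * (2 * η) := by ring
  exact le_of_mul_le_mul_left h2 (by positivity)

/-- **CIL ⇒ the fat-minority linear bound (d₀ = 0, C = 2).**  If for every finite weighted graph, every
nonempty relay set `A`, and every observer `o ∉ A` some relay `a ∈ A` satisfies
`P(1 ≤ N ∧ 2N ≤ |A|) ≤ P(2|π(a)| ≤ |A|)` (the cumulative isolation lemma at level `⌊|A|/2⌋`), then
`P(0 < N ∧ 2N ≤ |A|) ≤ 2 (P(o ↮ A) + η)` whenever all pairwise disconnections are `≤ η`. -/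
theorem fatMinorityLinear_of_cumulativeIsolation
    (hCIL : ∀ (n : ℕ) (w : Sym2 (Fin n) → unitInterval) (A : Finset (Fin n)) (o : Fin n),
      A.Nonempty → o ∉ A → ∃ a ∈ A,
        (prodBernoulli w).real {ω : BondConfig (Fin n) |
            1 ≤ (A.filter fun x => ω ∈ openConn o x).card ∧
              2 * (A.filter fun x => ω ∈ openConn o x).card ≤ A.card} ≤
          (prodBernoulli w).real {ω : BondConfig (Fin n) |
            2 * (A.filter fun x => ω ∈ openConn a x).card ≤ A.card}) :
    ∃ (d₀ : ℕ) (C : ℝ), 0 ≤ C ∧ ∀ (n : ℕ) (w : Sym2 (Fin n) → unitInterval) (A : Finset (Fin n))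
      (o : Fin n) (η : ℝ), 0 ≤ η → o ∉ A →
      (∀ a ∈ A, ∀ a' ∈ A, (Literature.Probability.LatticeModels.prodBernoulli w).real
        (Literature.Probability.Percolation.openConn a a')ᶜ ≤ η) →
      (Literature.Probability.LatticeModels.prodBernoulli w).real
          {ω : Literature.Probability.Percolation.BondConfig (Fin n) |
            d₀ < (A.filter fun a => ω ∈ Literature.Probability.Percolation.openConn o a).card ∧
              2 * (A.filter fun a => ω ∈ Literature.Probability.Percolation.openConn o a).card ≤
                A.card} ≤
        C * ((Literature.Probability.LatticeModels.prodBernoulli w).real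
          (⋃ a ∈ A, Literature.Probability.Percolation.openConn o a)ᶜ + η) := by
  refine ⟨0, 2, by norm_num, fun n w A o η hη ho hpair => ?_⟩
  have hcompl : 0 ≤ (prodBernoulli w).real (⋃ a ∈ A, (openConn o a : Set (BondConfig (Fin n))))ᶜ :=
    measureReal_nonneg
  rcases A.eq_empty_or_nonempty with hAe | hAne
  · -- no relays: the event is empty
    have hempty : {ω : BondConfig (Fin n) |
        0 < (A.filter fun a => ω ∈ openConn o a).card ∧
          2 * (A.filter fun a => ω ∈ openConn o a).card ≤ A.card} = ∅ := by
      ext ω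
      simp [hAe]
    rw [hempty, measureReal_empty]
    nlinarith
  · obtain ⟨a, ha, hle⟩ := hCIL n w A o hAne ho
    have h2 := smallBlock_le_two_mul w A a η ha (fun a' ha' => hpair a ha a' ha')
    have hev : {ω : BondConfig (Fin n) |
        0 < (A.filter fun a => ω ∈ openConn o a).card ∧
          2 * (A.filter fun a => ω ∈ openConn o a).card ≤ A.card} =
        {ω : BondConfig (Fin n) |
          1 ≤ (A.filter fun x => ω ∈ openConn o x).card ∧
            2 * (A.filter fun x => ω ∈ openConn o x).card ≤ A.card} := by
      ext ω; simp only [Set.mem_setOf_eq]; omega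
    rw [hev]
    linarith

/-- **The cumulative isolation lemma (level `⌊|A|/2⌋`) closes the crux `NoHeavyLowerTail`**, through the
landed `noHeavyLowerTail_of_fatMinorityLinear` (`d₀ = 0`, `C = 2`). -/
theorem noHeavyLowerTail_of_cumulativeIsolation
    (hCIL : ∀ (n : ℕ) (w : Sym2 (Fin n) → unitInterval) (A : Finset (Fin n)) (o : Fin n),
      A.Nonempty → o ∉ A → ∃ a ∈ A,
        (prodBernoulli w).real {ω : BondConfig (Fin n) |
            1 ≤ (A.filter fun x => ω ∈ openConn o x).card ∧
              2 * (A.filter fun x => ω ∈ openConn o x).card ≤ A.card} ≤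
          (prodBernoulli w).real {ω : BondConfig (Fin n) |
            2 * (A.filter fun x => ω ∈ openConn a x).card ≤ A.card}) :
    Summit.CriticalPhenomena.PercolationContinuityZ3.Theses.PercNearOneGluing.NoHeavyLowerTail :=
  noHeavyLowerTail_of_fatMinorityLinear (fatMinorityLinear_of_cumulativeIsolation hCIL)

/-- **The registered stub `stub_cumulativeIsolation` (all levels `j`) closes the crux.**  The stub is the
cumulative isolation lemma in the form `∀ j, ∃ a ∈ A, P(1 ≤ N ≤ j) ≤ P(|π(a)| ≤ j)`; instantiate
`j := ⌊|A|/2⌋` (`N ≤ ⌊|A|/2⌋ ↔ 2N ≤ |A|`) and apply `noHeavyLowerTail_of_cumulativeIsolation`. -/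
theorem noHeavyLowerTail_of_stub_cumulativeIsolation
    (hCIL : ∀ (n : ℕ) (w : Sym2 (Fin n) → unitInterval) (A : Finset (Fin n)) (o : Fin n) (j : ℕ),
      A.Nonempty → o ∉ A → ∃ a ∈ A,
        (Literature.Probability.LatticeModels.prodBernoulli w).real
            {ω : Literature.Probability.Percolation.BondConfig (Fin n) |
              1 ≤ (A.filter fun x => ω ∈ Literature.Probability.Percolation.openConn o x).card ∧
                (A.filter fun x => ω ∈ Literature.Probability.Percolation.openConn o x).card ≤ j} ≤
          (Literature.Probability.LatticeModels.prodBernoulli w).real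
            {ω : Literature.Probability.Percolation.BondConfig (Fin n) |
              (A.filter fun x => ω ∈ Literature.Probability.Percolation.openConn a x).card ≤ j}) :
    Summit.CriticalPhenomena.PercolationContinuityZ3.Theses.PercNearOneGluing.NoHeavyLowerTail := by
  refine noHeavyLowerTail_of_cumulativeIsolation fun n w A o hA ho => ?_
  obtain ⟨a, ha, hle⟩ := hCIL n w A o (A.card / 2) hA ho
  refine ⟨a, ha, ?_⟩
  have e1 : {ω : BondConfig (Fin n) |
      1 ≤ (A.filter fun x => ω ∈ openConn o x).card ∧
        2 * (A.filter fun x => ω ∈ openConn o x).card ≤ A.card} =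
      {ω : BondConfig (Fin n) |
        1 ≤ (A.filter fun x => ω ∈ openConn o x).card ∧
          (A.filter fun x => ω ∈ openConn o x).card ≤ A.card / 2} := by
    ext ω; simp only [Set.mem_setOf_eq]; omega
  have e2 : {ω : BondConfig (Fin n) | 2 * (A.filter fun x => ω ∈ openConn a x).card ≤ A.card} =
      {ω : BondConfig (Fin n) | (A.filter fun x => ω ∈ openConn a x).card ≤ A.card / 2} := by
    ext ω; simp only [Set.mem_setOf_eq]; omega
  rw [e1, e2]
  exact hle

end Summit.CriticalPhenomena.PercolationContinuityZ3.Theorems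

end
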